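import Mathlib
import HarnessLib
import Summits.HubbardSuperconductivity.HubbardSuperconductivity.Theorems.KLProgrammeKLRegimeSectorSliceRowsTelescope

/-!
# Route `KLProgramme` — crux K3 ENGINE (stmt-HubbardSuperconductivity-20437) stub (b) conj. 2 «(c-D)² FAMILY TELESCOPE», brick (D5g): weighted rows /
# columns along a CHAIN of matrices — base plus the sum of the per-step pieces (the simultaneous family + band telescope's bookkeeping)

Cell `gate-hubbard-kl`, seat hubbard-kl-k3c3-p2 (g11); F1-DESIGN §2.  Generic matrix bookkeeping on `rowSumWt_norm_add_sum_le` /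
`colSumWt_norm_add_sum_le` (`…SectorSliceRowsTelescope`): for `A : ℕ → Matrix`, `A(m₀+d) = A(m₀) + Σ_{i<d} (A(m₀+i+1) − A(m₀+i))`, and each step
splits as a FAMILY piece plus a COVARIANCE piece,

* `rowSumWt_norm_chain_le` / `colSumWt_norm_chain_le` — weighted rows/columns of `A(m₀+d)` `≤` those of `A(m₀)` plus the sum of those of the steps;
* **`rowSumWt_norm_chain_le_of_pieces`** / **`colSumWt_…`** — with `A(m₀+i+1) − A(m₀+i) = F i + C i` and per-piece bounds `φ i`, `ψ i`:
  `rows(A(m₀+d)) ≤ rows(A(m₀)) + Σ_{i<d} (φ i + ψ i)`; `…_const` — uniform bounds give `rows(A(m₀)) + d·(φ + ψ)`.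

Pure bookkeeping; no definitions, no sorry. [cite: BenfattoGiulianiMastropietro2006, §3 (3.2)–(3.3)]
-/

noncomputable section

namespace Summit.HubbardSuperconductivity.HubbardSuperconductivity.Theorems.TorusFourierL2

set_option linter.dupNamespace false -- summit = problem name (single-conjunct summit), D-0017

open Finset

section Chain

variable {α : Type*} [Fintype α]

omit [Fintype α] in
/-- Telescoping a chain of matrices: `A(m₀+d) = A(m₀) + Σ_{i<d} (A(m₀+i+1) − A(m₀+i))`. [folklore] -/
theorem matrix_chain_eq (A : ℕ → Matrix α α ℂ) (m₀ d : ℕ) :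
    A (m₀ + d) = A m₀ + ∑ i ∈ range d, (A (m₀ + i + 1) - A (m₀ + i)) := by
  induction d with
  | zero => simp
  | succ d ih =>
    rw [Finset.sum_range_succ, ← add_assoc (A m₀), ← ih, show m₀ + (d + 1) = m₀ + d + 1 by omega]
    abel

/-- **Weighted rows along a chain**: `Σ_y ‖A(m₀+d) x y‖·w ≤ Σ_y ‖A(m₀) x y‖·w + Σ_{i<d} Σ_y ‖(A(m₀+i+1) − A(m₀+i)) x y‖·w` (`w ≥ 0`). [folklore] -/
theorem rowSumWt_norm_chain_le (A : ℕ → Matrix α α ℂ) (w : α → α → ℝ) (hw : ∀ x y, 0 ≤ w x y) (m₀ d : ℕ) (x : α) :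
    ∑ y, ‖A (m₀ + d) x y‖ * w x y ≤ ∑ y, ‖A m₀ x y‖ * w x y + ∑ i ∈ range d, ∑ y, ‖(A (m₀ + i + 1) - A (m₀ + i)) x y‖ * w x y := by
  rw [matrix_chain_eq A m₀ d]
  exact rowSumWt_norm_add_sum_le (range d) (A m₀) (fun i => A (m₀ + i + 1) - A (m₀ + i)) w hw x

/-- **Weighted columns along a chain**. [folklore] -/
theorem colSumWt_norm_chain_le (A : ℕ → Matrix α α ℂ) (w : α → α → ℝ) (hw : ∀ x y, 0 ≤ w x y) (m₀ d : ℕ) (y : α) :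
    ∑ x, ‖A (m₀ + d) x y‖ * w x y ≤ ∑ x, ‖A m₀ x y‖ * w x y + ∑ i ∈ range d, ∑ x, ‖(A (m₀ + i + 1) - A (m₀ + i)) x y‖ * w x y := by
  rw [matrix_chain_eq A m₀ d]
  exact colSumWt_norm_add_sum_le (range d) (A m₀) (fun i => A (m₀ + i + 1) - A (m₀ + i)) w hw y

/-- **Weighted rows along a chain whose steps split into two pieces with per-piece bounds**:
`A(m₀+i+1) − A(m₀+i) = F i + C i`, `rows(F i) ≤ φ i`, `rows(C i) ≤ ψ i` ⇒ `rows(A(m₀+d)) ≤ rows(A m₀) + Σ_{i<d} (φ i + ψ i)`.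
[cite: BenfattoGiulianiMastropietro2006, §3 (3.2)–(3.3)] -/
theorem rowSumWt_norm_chain_le_of_pieces (A F C : ℕ → Matrix α α ℂ) (w : α → α → ℝ) (hw : ∀ x y, 0 ≤ w x y) (m₀ d : ℕ) (x : α)
    (hsplit : ∀ i < d, A (m₀ + i + 1) - A (m₀ + i) = F i + C i) (φ ψ : ℕ → ℝ)
    (hF : ∀ i < d, ∑ y, ‖F i x y‖ * w x y ≤ φ i) (hC : ∀ i < d, ∑ y, ‖C i x y‖ * w x y ≤ ψ i) :
    ∑ y, ‖A (m₀ + d) x y‖ * w x y ≤ ∑ y, ‖A m₀ x y‖ * w x y + ∑ i ∈ range d, (φ i + ψ i) := by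
  refine (rowSumWt_norm_chain_le A w hw m₀ d x).trans (add_le_add le_rfl (Finset.sum_le_sum fun i hi => ?_))
  rw [Finset.mem_range] at hi
  rw [hsplit i hi]
  calc ∑ y, ‖(F i + C i) x y‖ * w x y ≤ ∑ y, (‖F i x y‖ * w x y + ‖C i x y‖ * w x y) :=
        Finset.sum_le_sum fun y _ => by rw [Matrix.add_apply, ← add_mul]; exact mul_le_mul_of_nonneg_right (norm_add_le _ _) (hw x y)
    _ = ∑ y, ‖F i x y‖ * w x y + ∑ y, ‖C i x y‖ * w x y := Finset.sum_add_distrib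
    _ ≤ φ i + ψ i := add_le_add (hF i hi) (hC i hi)

/-- **Weighted columns along a chain whose steps split into two pieces with per-piece bounds**. [cite: BenfattoGiulianiMastropietro2006, §3 (3.2)–(3.3)] -/
theorem colSumWt_norm_chain_le_of_pieces (A F C : ℕ → Matrix α α ℂ) (w : α → α → ℝ) (hw : ∀ x y, 0 ≤ w x y) (m₀ d : ℕ) (y : α)
    (hsplit : ∀ i < d, A (m₀ + i + 1) - A (m₀ + i) = F i + C i) (φ ψ : ℕ → ℝ)
    (hF : ∀ i < d, ∑ x, ‖F i x y‖ * w x y ≤ φ i) (hC : ∀ i < d, ∑ x, ‖C i x y‖ * w x y ≤ ψ i) :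
    ∑ x, ‖A (m₀ + d) x y‖ * w x y ≤ ∑ x, ‖A m₀ x y‖ * w x y + ∑ i ∈ range d, (φ i + ψ i) := by
  refine (colSumWt_norm_chain_le A w hw m₀ d y).trans (add_le_add le_rfl (Finset.sum_le_sum fun i hi => ?_))
  rw [Finset.mem_range] at hi
  rw [hsplit i hi]
  calc ∑ x, ‖(F i + C i) x y‖ * w x y ≤ ∑ x, (‖F i x y‖ * w x y + ‖C i x y‖ * w x y) :=
        Finset.sum_le_sum fun x _ => by rw [Matrix.add_apply, ← add_mul]; exact mul_le_mul_of_nonneg_right (norm_add_le _ _) (hw x y)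
    _ = ∑ x, ‖F i x y‖ * w x y + ∑ x, ‖C i x y‖ * w x y := Finset.sum_add_distrib
    _ ≤ φ i + ψ i := add_le_add (hF i hi) (hC i hi)

/-- **Uniform per-piece bounds: `rows(A(m₀+d)) ≤ rows(A m₀) + d·(φ + ψ)`.** [cite: BenfattoGiulianiMastropietro2006, §3 (3.2)–(3.3)] -/
theorem rowSumWt_norm_chain_le_const (A F C : ℕ → Matrix α α ℂ) (w : α → α → ℝ) (hw : ∀ x y, 0 ≤ w x y) (m₀ d : ℕ) (x : α)
    (hsplit : ∀ i < d, A (m₀ + i + 1) - A (m₀ + i) = F i + C i) {φ ψ : ℝ}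
    (hF : ∀ i < d, ∑ y, ‖F i x y‖ * w x y ≤ φ) (hC : ∀ i < d, ∑ y, ‖C i x y‖ * w x y ≤ ψ) :
    ∑ y, ‖A (m₀ + d) x y‖ * w x y ≤ ∑ y, ‖A m₀ x y‖ * w x y + (d : ℝ) * (φ + ψ) := by
  have h := rowSumWt_norm_chain_le_of_pieces A F C w hw m₀ d x hsplit (fun _ => φ) (fun _ => ψ) hF hC
  rw [Finset.sum_const, Finset.card_range, nsmul_eq_mul] at h
  exact h

/-- **Uniform per-piece bounds, columns: `cols(A(m₀+d)) ≤ cols(A m₀) + d·(φ + ψ)`.** [cite: BenfattoGiulianiMastropietro2006, §3 (3.2)–(3.3)] -/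
theorem colSumWt_norm_chain_le_const (A F C : ℕ → Matrix α α ℂ) (w : α → α → ℝ) (hw : ∀ x y, 0 ≤ w x y) (m₀ d : ℕ) (y : α)
    (hsplit : ∀ i < d, A (m₀ + i + 1) - A (m₀ + i) = F i + C i) {φ ψ : ℝ}
    (hF : ∀ i < d, ∑ x, ‖F i x y‖ * w x y ≤ φ) (hC : ∀ i < d, ∑ x, ‖C i x y‖ * w x y ≤ ψ) :
    ∑ x, ‖A (m₀ + d) x y‖ * w x y ≤ ∑ x, ‖A m₀ x y‖ * w x y + (d : ℝ) * (φ + ψ) := by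
  have h := colSumWt_norm_chain_le_of_pieces A F C w hw m₀ d y hsplit (fun _ => φ) (fun _ => ψ) hF hC
  rw [Finset.sum_const, Finset.card_range, nsmul_eq_mul] at h
  exact h

omit [Fintype α] in
/-- The simultaneous step of a conjugated chain splits into the FAMILY piece (new band) plus the COVARIANCE piece (old family):
`S′ᵀC′S′ − SᵀCS = (S′ᵀC′S′ − SᵀC′S) + Sᵀ(C′ − C)S`. [folklore] -/
theorem conj_step_split {β γ : Type*} [Fintype β] [Fintype γ] (S S' : Matrix β α ℂ) (C C' : Matrix β β ℂ) :
    S'.transpose * C' * S' - S.transpose * C * S = (S'.transpose * C' * S' - S.transpose * C' * S) + S.transpose * (C' - C) * S := by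
  rw [Matrix.mul_sub, Matrix.sub_mul]; abel

/-- Weighted rows are invariant under negation of the matrix. [folklore] -/
theorem rowSumWt_norm_neg (A : Matrix α α ℂ) (w : α → α → ℝ) (x : α) : ∑ y, ‖(-A) x y‖ * w x y = ∑ y, ‖A x y‖ * w x y :=
  Finset.sum_congr rfl fun y _ => by rw [Matrix.neg_apply, norm_neg]

/-- Weighted columns are invariant under negation of the matrix. [folklore] -/
theorem colSumWt_norm_neg (A : Matrix α α ℂ) (w : α → α → ℝ) (y : α) : ∑ x, ‖(-A) x y‖ * w x y = ∑ x, ‖A x y‖ * w x y :=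
  Finset.sum_congr rfl fun x _ => by rw [Matrix.neg_apply, norm_neg]

end Chain

end Summit.HubbardSuperconductivity.HubbardSuperconductivity.Theorems.TorusFourierL2

end
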